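import Literature.IUT.HodgeArakelov.MonoThetaCyclotomesBridgeEtTh
import Literature.IUT.HodgeArakelov.ModelReconstruction
import Literature.IUT.HodgeArakelov.MonoThetaFromGroups
import Literature.AnabelianGeometry.EtaleTheta.RigidOfSetting

/-!
# Bridge B8, part 6 (assembly): the [IUTchII] Def. 1.1 output EXISTS for every mono-theta environment of the
# setting built from an [EtTh] rigidity interface — and for the Tate curve of an [EtTh] §1 theta setting

abc-iut cell, bridge **B8** (abc-iut-L6-d6); assembles parts 2/3 (`ThetaSetting.ofThetaEnvData`,
`ofDoubleUnderline`), 5a/5b (`ModelCyclotomes`, `ModelReconstruction`) and 4 (`Def11OutputTransport`).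

* `ThetaSetting.modelFrameOfThetaEnvData`: for the [IUTchII] §1 setting BUILT from `R : RigidData N l` (part 2,
  `ofThetaEnvData R.toThetaEnvData X`) the frame of part 5b is the identity; its three extra properties
  (`Π^tp_X` T₁, `Δ_X` closed, `(l·Δ_Θ)/thetaKer ≅ Ẑ`) stay hypotheses at this generality;
* `ThetaSetting.nonempty_def11Output_ofThetaEnvData`: hence EVERY `M : MonoThetaEnv (ofThetaEnvData …)` carries a
  Def. 1.1 (i)+(ii) output (`Def11Output M`) — the EXISTENCE clause "there exist functorial group-theoretic
  algorithms …" of [IUTchII] Def. 1.1 (kurims pp. 20–21), which abc-iut-L6-t1 deliberately left untyped as a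
  named fact (false for junk settings), DISCHARGED for the settings that come from [EtTh] data;
* `ThetaSetting.envOfGroup`: likewise the OUTPUT `EnvOfGroup` of [IUTchII] Prop. 1.2 (i) ("`Π ↦ M^Θ(Π)` with a
  functorial isomorphism `Π ≅ Π_X(M^Θ(Π))`", `MonoThetaFromGroups`, abc-iut-L6-t1) EXISTS for every topological
  group `Π ≅ Π^tp_X` of that setting: `M^Θ(Π) :=` the [EtTh] model, `Π_X(M^Θ(Π)) = Π^tp_X`;
* for the Tate curve `X̲̲_K` of an [EtTh] §1 theta setting (L2-t8's `DoubleUnderline.rigidData`,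
  `RigidOfSetting.lean` p409073, whose `toThetaEnvData` is `thetaEnvData` by `rfl`): `Π^tp_{X̲̲}` IS T₁ (indeed T₂: it
  injects continuously into the profinite completion — `t2Space_PiTemp`) and `Δ` IS closed
  (`isClosed_ker_aug_thetaEnvData`), so only "`l·Δ_Θ ≅ Ẑ(1)` as an abstract group" ([EtTh] §1 p. 12, not recorded
  by the L2 interface) remains a hypothesis: `nonempty_def11Output_ofDoubleUnderline`.

HONEST FRAMING: assembly of the cell's own constructions over a refereed source's typed interface; nothing
disputed is asserted; no side is taken on [IUTchIII] Cor. 3.12; typed ≠ discharged. [IUTchII] §1 Def. 1.1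
[claim: Mochizuki2012, status: disputed] (IUTchII §1 Def 1.1, kurims pp.20-21); [cite: MochizukiEtTh2009, Cor 2.19(i) p.64].
-/

noncomputable section

namespace Literature.IUT.HodgeArakelov

universe u

open Literature.AnabelianGeometry.EtaleTheta Literature.AnabelianGeometry.SemiGraphs
open scoped Literature.AnabelianGeometry.EtaleTheta

namespace ThetaSetting

/-! ## The setting built from `R : RigidData N l` -/

section OfRigidData

variable {N : ℕ+} {l : ℕ} (R : RigidData.{u} N l) [TopologicalSpace R.G] [IsTopologicalGroup R.G]
  (X : SideData R.toThetaEnvData)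

/-- **The frame of the setting built from `R` is the identity** (`Π^tp_X = S.PiX`, `Δ = Δ`); the three
properties the [EtTh] interface does not record are passed through.
[claim: Mochizuki2012, status: disputed] (IUTchII §1 Def 1.1 (i), kurims pp.20-21) -/
def modelFrameOfThetaEnvData (h1 : T1Space R.PiX)
    (h2 : IsClosed (((R.aug.ker : Subgroup R.PiX)) : Set R.PiX))
    (h3 : Nonempty (ModelCyclotomes.lDeltaQuot R ≃* Literature.IUT.HodgeTheaters.ZHat)) :
    ModelFrame (ofThetaEnvData R.toThetaEnvData X) R where
  eX := ContinuousMulEquiv.refl R.PiX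
  map_ker := by
    ext x
    constructor
    · rintro ⟨y, hy, rfl⟩
      exact hy
    · intro hx
      exact ⟨x, hx, rfl⟩
  t1Space := h1
  isClosed_ker_aug := h2
  int_iso_ZHat := h3

/-- **EXISTENCE of the [IUTchII] Def. 1.1 output** for EVERY mono-theta environment of the setting built from an
[EtTh] rigidity interface (modulo the three named topological/cyclotome properties): `M ≅ model` by `isModel`,
the model's output by part 5b, transported by part 4. [claim: Mochizuki2012, status: disputed] (IUTchII §1 Def 1.1, kurims pp.20-21) -/
theorem nonempty_def11Output_ofThetaEnvData (h1 : T1Space R.PiX)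
    (h2 : IsClosed (((R.aug.ker : Subgroup R.PiX)) : Set R.PiX))
    (h3 : Nonempty (ModelCyclotomes.lDeltaQuot R ≃* Literature.IUT.HodgeTheaters.ZHat))
    (M : MonoThetaEnv (ofThetaEnvData R.toThetaEnvData X)) : Nonempty (Def11Output M) := by
  obtain ⟨e, -, -⟩ := M.isModel
  exact (modelFrameOfThetaEnvData R X h1 h2 h3).nonempty_def11Output e M

/-- A CHOSEN Def. 1.1 output for every mono-theta environment of that setting (noncomputable: through the
isomorphism to the model provided by `isModel`). [claim: Mochizuki2012, status: disputed] (IUTchII §1 Def 1.1, kurims pp.20-21) -/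
def def11OutputOfThetaEnvData (h1 : T1Space R.PiX)
    (h2 : IsClosed (((R.aug.ker : Subgroup R.PiX)) : Set R.PiX))
    (h3 : Nonempty (ModelCyclotomes.lDeltaQuot R ≃* Literature.IUT.HodgeTheaters.ZHat))
    (M : MonoThetaEnv (ofThetaEnvData R.toThetaEnvData X)) : Def11Output M :=
  (nonempty_def11Output_ofThetaEnvData R X h1 h2 h3 M).some

/-- **EXISTENCE of the [IUTchII] Prop. 1.2 (i) output `Π ↦ M^Θ(Π)`** for every topological group `Π`
isomorphic to `Π^tp_X` of the setting built from `R` (modulo the same three properties): `M^Θ(Π) :=` the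
[IUTchII]-typed environment underlain by the [EtTh] model (part 2 `ofEtale`), its Def. 1.1 (i) output by part 5b
(so `Π_X(M^Θ(Π)) = Π^tp_X`), and the functorial isomorphism `Π ≅ Π_X(M^Θ(Π)) :=` the given one.
[claim: Mochizuki2012, status: disputed] (IUTchII §1 Prop 1.2 (i), kurims p.25) -/
def envOfGroup (h1 : T1Space R.PiX)
    (h2 : IsClosed (((R.aug.ker : Subgroup R.PiX)) : Set R.PiX))
    (h3 : Nonempty (ModelCyclotomes.lDeltaQuot R ≃* Literature.IUT.HodgeTheaters.ZHat))
    (P : TopGroup.{u}) (hP : Nonempty (P ≃ₜ* (ofThetaEnvData R.toThetaEnvData X).PiX)) :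
    EnvOfGroup (ofThetaEnvData R.toThetaEnvData X) P where
  isoRef := hP
  env := MonoThetaEnv.ofEtale (R.toThetaEnvData.modelMono X.mem)
    ⟨MonoThetaBridge.etaleIsoOfEq (modelEnv_ofThetaEnvData R.toThetaEnvData X).symm⟩
  recon := (modelFrameOfThetaEnvData R X h1 h2 h3).reconstruction (ContinuousMulEquiv.refl _)
  isoX := hP.some

/-- Existence form of `envOfGroup`. [claim: Mochizuki2012, status: disputed] (IUTchII §1 Prop 1.2 (i), kurims p.25) -/
theorem nonempty_envOfGroup (h1 : T1Space R.PiX)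
    (h2 : IsClosed (((R.aug.ker : Subgroup R.PiX)) : Set R.PiX))
    (h3 : Nonempty (ModelCyclotomes.lDeltaQuot R ≃* Literature.IUT.HodgeTheaters.ZHat))
    (P : TopGroup.{u}) (hP : Nonempty (P ≃ₜ* (ofThetaEnvData R.toThetaEnvData X).PiX)) :
    Nonempty (EnvOfGroup (ofThetaEnvData R.toThetaEnvData X) P) :=
  ⟨envOfGroup R X h1 h2 h3 P hP⟩

end OfRigidData

/-! ## The Tate curve of an [EtTh] §1 theta setting (L2-t8's `rigidData`) -/

section Tate

variable {p : ℕ} [Fact p.Prime] {D : Literature.AnabelianGeometry.EtaleTheta.ThetaSetting p}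
  {E : D.EtaleThetaData} {l : ℕ} (C : E.DoubleUnderline l) {N : ℕ+} (μ : D.CyclotomeMod l N)
  (hC : D.Compat) (hS : D.Sec2Hyps)

/-- The tempered fundamental group `Π^tp_X` of an [EtTh] §1 theta setting is HAUSDORFF: it injects continuously
into its profinite completion (`TemperedCurve.toHat_injective`). [cite: MochizukiEtTh2009, §1 p.12] -/
theorem t2Space_PiTemp : T2Space D.PiTemp :=
  haveI : T2Space D.PiHat := D.isProfiniteCompletion_toHat.t2Space
  T2Space.of_injective_continuous D.toHat_injective D.toHat.continuous

/-- Hence `Π^tp_{X̲̲} ⊆ Π^tp_X` is T₁. [cite: MochizukiEtTh2009, §1 p.12] -/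
theorem t1Space_Huu : T1Space ↥C.Huu :=
  haveI := t2Space_PiTemp (D := D)
  inferInstance

/-- `G_{ℚ_p}` with its Krull topology is Hausdorff (`ℚ̄_p/ℚ_p` algebraic). [cite: MochizukiEtTh2009, §1 p.12] -/
theorem t2Space_GQp : T2Space (GQp p) := krullTopology_t2

/-- `Δ = Ker(Π^tp_{X̲̲} ↠ G_K)` is CLOSED (the augmentation is continuous into the Hausdorff `G_K ⊆ G_{ℚ_p}`).
[cite: MochizukiEtTh2009, §1 p.12] -/
theorem isClosed_ker_aug_thetaEnvData :
    IsClosed ((((C.thetaEnvData μ hC hS).aug.ker : Subgroup (C.thetaEnvData μ hC hS).PiX)) :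
      Set (C.thetaEnvData μ hC hS).PiX) := by
  haveI := t2Space_GQp (p := p)
  show IsClosed ((fun x : (C.thetaEnvData μ hC hS).PiX => (C.thetaEnvData μ hC hS).aug x) ⁻¹' {1})
  exact isClosed_singleton.preimage (continuous_aug_thetaEnvData C μ hC hS)

/-- **EXISTENCE of the [IUTchII] Def. 1.1 output for the Tate curve `X̲̲_K`**: every mono-theta environment of
the [IUTchII] §1 setting `ofDoubleUnderline` (part 3) carries a Def. 1.1 (i)+(ii) output, over L2-t8's REAL
rigidity data `C.rigidData μ hC hS h15 L` — modulo L2-t1's named fact `Prop15iii` (input of `rigidData`) and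
the ONE property the L2 interface does not record: `(l·Δ_Θ)/thetaKer ≅ Ẑ` abstractly ([EtTh] §1 p. 12
"`Δ_Θ (≅ Ẑ(1))`"). T₁-ness of `Π^tp_{X̲̲}` and closedness of `Δ` are PROVED here.
[claim: Mochizuki2012, status: disputed] (IUTchII §1 Def 1.1, kurims pp.20-21) -/
theorem nonempty_def11Output_ofDoubleUnderline
    (h15 : Literature.AnabelianGeometry.EtaleTheta.ThetaSetting.Prop15iii E hC) (L : C.CuspLabels)
    (hl : l.Prime) (hp2 : p ≠ 2) (hpl : p ≠ l) (hζ : ∃ ζ : D.K, IsPrimitiveRoot ζ (4 * l))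
    {η : (C.thetaEnvData μ hC hS).PiYdd → MuN p N} (hη : η ∈ (C.thetaEnvData μ hC hS).thetaCocycles)
    (hZ : Nonempty (ModelCyclotomes.lDeltaQuot (C.rigidData μ hC hS h15 L) ≃* Literature.IUT.HodgeTheaters.ZHat))
    (M : MonoThetaEnv (ofDoubleUnderline C μ hC hS hl hp2 hpl hζ hη)) : Nonempty (Def11Output M) :=
  nonempty_def11Output_ofThetaEnvData (C.rigidData μ hC hS h15 L)
    (SideData.ofDoubleUnderline C μ hC hS hl hp2 hpl hζ hη) (t1Space_Huu C)
    (isClosed_ker_aug_thetaEnvData C μ hC hS) hZ M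

end Tate

end ThetaSetting

end Literature.IUT.HodgeArakelov
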